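import Summits.QuantumFields.YangMills.Theorems.AlphaInputsT3ACv3AbelianStokes
import Literature.MathematicalPhysics.QuantumFieldTheory.Balaban1983to89.T3PrintedRegularMinimiser
import Literature.MathematicalPhysics.QuantumFieldTheory.Balaban1983to89.B7Prop8PrintedConstants
import Literature.MathematicalPhysics.QuantumFieldTheory.Balaban1983to89.B9AdOrthogonal
import HarnessLib

/-!
# Route `UnitScaleTilt`, crux K1 child «MinimiserStabilityRegPr» (stmt-QuantumFields-19200), stub `stub_existenceMinimalOrbit` (EX), line «SYM-CENTRE» (★★OWNER RULING
# g28-№7 cure (ii-a)), row (R4)-DICT — **THE ABELIAN DICTIONARY: BOTH CLAUSES OF PRINT'S REGULAR SPACE `𝔘_k(ε₀)` FOR A ONE-PARAMETER-SUBGROUP CONFIGURATION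
# `b ↦ e^{θ(b)·Y}` (`Y ∈ 𝔰𝔲(N)`) FROM THE SUP AND THE LIPSCHITZ ROW OF THE LATTICE CURL OF `θ`**

Cell `ym3-torus`, width seat `ym3-torus-px19` (g3); ★px20 g2 (line pen) «px19: R4-DICT GO» 2026-08-28T22:30:05Z.  `--supports stmt-QuantumFields-19200 --as helper`; THEOREMS ONLY
(0 `def`, 0 `sorry`); count-neutral; nothing here claims the stub, the crux, d = 4 or the mass gap — YM₃ on T³ is a ladder rung (R3), not the Clay problem.

WHY.  The symmetric-centre row `hSymCentre` of the re-centred EX display (text of record `…w2-19200 g6` 2026-08-28T22:08:41Z: centre `U₁` with `RegPr … (CS·ε₁) U₁`) is, in the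
reducible sector `p(V) = 1` (LOCATE #56 of seat px20 g2), supplied by an ABELIAN fine field `U₁ = ĝ⁻¹·(b ↦ e^{a(b)·Y})·ĝ` whose real one-form `a` is the smooth exact lift
✓`LinearLiftSpreadLip.exists_smoothExactLift_torus` (rows: `|curlAt a| ≤ C₁ε/(L^k)²` and `|curlAt a (x + e_λ) − curlAt a x| ≤ C₂ε/(L^k)³`).  THIS FILE is the dictionary
from those two REAL rows to the two clauses of `T3PrintedRegularMinimiser.RegPr` (plaquettes `dist1 (U(∂p)) < regThreshold`, divergence `‖(D^{1*}_U ∂U)(b)‖ < ε₀L^{−3(K−n)}`)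
for the abelian configuration `gexpAt (suGroupModel N) hY θ : b ↦ gexp(θ b) = e^{θ(b)·Y}` of ✓`AlphaInputsT3ACv3AbelianEML` (any `Y ∈ 𝔰𝔲(N)`; for `N = 2` and `Y = iσ₃`
this is the diagonal field `diag(e^{iθ}, e^{−iθ})`).  No Taylor remainder is needed: `‖e^{tY} − 1‖ ≤ |t|·‖Y‖` is SHARP for skew-adjoint `Y` ([Balaban1985Averaging] (24)), and
all bond∕plaquette values commute, so the rotations `R(U(b))` of the covariant derivative act trivially.
* §1 (matrices, `L²`-operator norm) `star_eq_neg_of_mem_su`, `norm_exp_smul_sub_one_le` (`‖e^{tY} − 1‖ ≤ |t|‖Y‖`), `norm_coe_gexp_le_one`, `commute_exp_smul`,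
  ★ `norm_exp_smul_sub_exp_smul_le` (`‖e^{sY} − e^{tY}‖ ≤ |s − t|‖Y‖`), `conjR_inv_eq_of_commute`.
* §2 (generic torus `P`, level `j`) `plaqHol_gexpAt_curlAt` (`U(∂p) = gexp(curlAt θ p)`), ★ `dist1_plaqHol_gexpAt_le` (`dist1 U(∂p) ≤ ‖Y‖·|curlAt θ p|`),
  ★★ `plaqSmall_gexpAt` (sup row ⇒ `PlaqSmall`).
* §3 (generic torus `P`, level `s`) `coe_holT_unitsField_toUField`, `plaqFT_gexpAt` (`(∂U)_{κμ}(y) = e^{curlAt θ y κ μ·Y}` read in `M_N(ℂ)`), `covDerivT_one_gexpAt`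
  (the covariant backward derivative of the plaquette field IS the plain backward difference of `e^{curl·Y}`), ★★ `norm_covDivT_one_gexpAt_le`
  (`‖(D^{1*}_U ∂U)_μ(x)‖ ≤ (d−1)·‖Y‖·δ₂` from the Lipschitz row `|curlAt θ (x+e_λ) − curlAt θ x| ≤ δ₂`).
* §5 (`N = 2`) `I_smul_sigma3_mem_lie` (`iσ₃ ∈ 𝔰𝔲(2)`), `norm_I_smul_sigma3_le_one` (`‖iσ₃‖ ≤ 1`), `coe_gexpAt_sigma3` — the letter `b ↦ e^{θ(b)·iσ₃} = diag(e^{iθ}, e^{−iθ})` of the reducible sector.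
* §4 (T³ series, `N = 2`) ★★★ `regPr_gexpAt_of_curl_rows` — `RegPr F n K ε₀ (gexpAt (suGroupModel 2) hY θ)` from the two real rows and the two windows
  `‖Y‖·δ₁ < regThreshold F n K ε₀`, `(d−1)·‖Y‖·δ₂ < ε₀·L^{−3(K−n)}`.
HONEST SCOPE.  Elementary; the inputs by name are ✓`AbelianEML.plaqHol_gexpAt`∕`coe_gexp_su`, ✓`B10Eq27TorusAxialLog.{holT_plaqWord, val_holT_unitsField, holT_toUField}`,
✓`B7Prop8PrintedConstants.norm_exp_sub_one_le_of_star_eq_neg` ((24) p. 21), ✓`B8Ineq170.cstar_unitary_norm_le_one`; nothing of [Balaban1985Variational]∕[Balaban1985RegularSpaces] is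
asserted beyond the definitions `RegPr`∕`DivSmall`∕`covDivT` it reads.  What this file does NOT do: the exact NONLINEAR fibre of the abelian field (abelian closed form of the (0.4)
tower), the flux split, the diagonalising gauge and `hLift` — the other bricks of (R4) (★px20 g2, ★px6 g3, ym-ust-20520-w5 g8).

References: T. Bałaban, CMP **98** (1985) 17–51 [Balaban1985Averaging] ((9) p.19, (19)–(24) p.21); CMP **102** (1985) 277–309 [Balaban1985Variational] ((2), (6) p.278);
*Regularity and decay of lattice Green's functions*, CMP **89** (1983)∕[Balaban1985RegularSpaces] ((1.1)–(1.2) p.76, (1.7)+(1.9) p.77).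
-/

set_option autoImplicit false

noncomputable section

open scoped Matrix.Norms.L2Operator

namespace Summit.QuantumFields.YangMills.Theorems.Prop7SymCentreAbelianDict

open NormedSpace Finset
open Literature.MathematicalPhysics.QuantumFieldTheory.Balaban1983to89
open Literature.MathematicalPhysics.QuantumFieldTheory.Balaban1983to89.B7Prop1Explicit (Letter plaqWord)
open Literature.MathematicalPhysics.QuantumFieldTheory.Balaban1983to89.B10Eq27TorusAxialLog
  (holT holT_plaqWord unitsField toUField val_unitsField val_holT_unitsField holT_toUField suIncl)
open Literature.MathematicalPhysics.QuantumFieldTheory.Balaban1983to89.B10Eq68TorusRegularity (covDivT covDerivT plaqFT)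
open Literature.MathematicalPhysics.QuantumFieldTheory.Balaban1983to89.B7Eq78Linearization (conjR conjR_apply)
open Literature.MathematicalPhysics.QuantumFieldTheory.Balaban1983to89.T3ContinuumYM3Torus
open Literature.MathematicalPhysics.QuantumFieldTheory.Balaban1983to89.T3RegularMinimiser (regThreshold)
open Literature.MathematicalPhysics.QuantumFieldTheory.Balaban1983to89.T3PrintedRegularMinimiser (RegPr DivSmall)
open Summit.QuantumFields.Balaban3D.Carriers (suGroupModel)
open Summit.QuantumFields.YangMills.Theorems.BalabanUVNodesN08AlphaAbelianLift (gexp gexp_add gexp_inv rho_gexp)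
open Summit.QuantumFields.YangMills.Theorems.AbelianEML (gexpAt curlAt plaqHol_gexpAt coe_gexp_su)

variable {N : ℕ}

/-! ## §1 One-parameter subgroups of `SU(N)` read in `M_N(ℂ)`: the sharp exponential bounds -/

/-- `Y ∈ 𝔰𝔲(N)` is skew-adjoint: `Y⋆ = −Y`. [cite: Balaban1985Averaging, (22) p.21] -/
theorem star_eq_neg_of_mem_su {Y : Matrix (Fin N) (Fin N) ℂ} (hY : Y ∈ Literature.Algebra.Lie.CompactKillingForm.su (Fin N)) : star Y = -Y := by
  have h := (Literature.Algebra.Lie.CompactKillingForm.mem_su_iff.1 hY).1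
  rw [Matrix.star_eq_conjTranspose]; exact h

/-- `(tY)⋆ = −(tY)` for real `t`. [cite: Balaban1985Averaging, (22) p.21] -/
theorem star_smul_eq_neg_of_mem_su {Y : Matrix (Fin N) (Fin N) ℂ} (hY : Y ∈ Literature.Algebra.Lie.CompactKillingForm.su (Fin N)) (t : ℝ) :
    star (((t : ℝ) : ℂ) • Y) = -(((t : ℝ) : ℂ) • Y) := by
  rw [star_smul, star_eq_neg_of_mem_su hY, smul_neg, Complex.star_def, Complex.conj_ofReal]

/-- **(24) p. 21, SHARP**: `‖e^{tY} − 1‖ ≤ |t|·‖Y‖` for `Y ∈ 𝔰𝔲(N)` (no Taylor remainder). [cite: Balaban1985Averaging, (24) p.21] -/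
theorem norm_exp_smul_sub_one_le {Y : Matrix (Fin N) (Fin N) ℂ} (hY : Y ∈ Literature.Algebra.Lie.CompactKillingForm.su (Fin N)) (t : ℝ) :
    ‖exp (((t : ℝ) : ℂ) • Y) - 1‖ ≤ |t| * ‖Y‖ := by
  letI : CStarAlgebra (Matrix (Fin N) (Fin N) ℂ) := B10Eq29TubeLine.cstarAlgebraMatrix N
  calc ‖exp (((t : ℝ) : ℂ) • Y) - 1‖ ≤ ‖((t : ℝ) : ℂ) • Y‖ := B7Prop8PrintedConstants.norm_exp_sub_one_le_of_star_eq_neg (star_smul_eq_neg_of_mem_su hY t)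
    _ = |t| * ‖Y‖ := by rw [norm_smul, Complex.norm_real, Real.norm_eq_abs]

variable [NeZero N] {Y : Matrix (Fin N) (Fin N) ℂ} (hY : Y ∈ (suGroupModel N).lie)

include hY

/-- `gexp t = e^{tY}` read in `M_N(ℂ)` has norm `≤ 1` (it is unitary). [cite: Balaban1985Averaging, (19) p.21] -/
theorem norm_exp_smul_le_one (t : ℝ) : ‖exp (((t : ℝ) : ℂ) • Y)‖ ≤ 1 := by
  letI : CStarAlgebra (Matrix (Fin N) (Fin N) ℂ) := B10Eq29TubeLine.cstarAlgebraMatrix N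
  rw [← coe_gexp_su hY t]
  exact B8Ineq170.cstar_unitary_norm_le_one (Matrix.specialUnitaryGroup_le_unitaryGroup (gexp (suGroupModel N) hY t).2)

omit [NeZero N] hY in
/-- All `e^{sY}`, `e^{tY}` commute. [folklore] -/
theorem commute_exp_smul (s t : ℝ) : Commute (exp (((s : ℝ) : ℂ) • Y)) (exp (((t : ℝ) : ℂ) • Y)) :=
  (((Commute.refl Y).smul_left ((s : ℝ) : ℂ)).smul_right ((t : ℝ) : ℂ)).exp

/-- **★ THE LIPSCHITZ BOUND OF THE ONE-PARAMETER SUBGROUP**: `‖e^{sY} − e^{tY}‖ ≤ |s − t|·‖Y‖` (`e^{sY} − e^{tY} = e^{tY}(e^{(s−t)Y} − 1)`, `‖e^{tY}‖ ≤ 1`, (24)).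
[cite: Balaban1985Averaging, (24) p.21] -/
theorem norm_exp_smul_sub_exp_smul_le (s t : ℝ) : ‖exp (((s : ℝ) : ℂ) • Y) - exp (((t : ℝ) : ℂ) • Y)‖ ≤ |s - t| * ‖Y‖ := by
  letI : NormedAlgebra ℚ (Matrix (Fin N) (Fin N) ℂ) := NormedAlgebra.restrictScalars ℚ ℂ (Matrix (Fin N) (Fin N) ℂ)
  have hc : Commute (((t : ℝ) : ℂ) • Y) ((((s - t : ℝ)) : ℂ) • Y) := ((Commute.refl Y).smul_left _).smul_right _
  have e : exp (((s : ℝ) : ℂ) • Y) = exp (((t : ℝ) : ℂ) • Y) * exp ((((s - t : ℝ)) : ℂ) • Y) := by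
    rw [← exp_add_of_commute hc, ← add_smul, show ((t : ℝ) : ℂ) + (((s - t : ℝ)) : ℂ) = ((s : ℝ) : ℂ) by push_cast; ring]
  calc ‖exp (((s : ℝ) : ℂ) • Y) - exp (((t : ℝ) : ℂ) • Y)‖
      = ‖exp (((t : ℝ) : ℂ) • Y) * (exp ((((s - t : ℝ)) : ℂ) • Y) - 1)‖ := by rw [mul_sub, mul_one, ← e]
    _ ≤ ‖exp (((t : ℝ) : ℂ) • Y)‖ * ‖exp ((((s - t : ℝ)) : ℂ) • Y) - 1‖ := norm_mul_le _ _
    _ ≤ 1 * (|s - t| * ‖Y‖) := mul_le_mul (norm_exp_smul_le_one hY t) (norm_exp_smul_sub_one_le hY (s - t)) (norm_nonneg _) zero_le_one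
    _ = |s - t| * ‖Y‖ := one_mul _

omit [NeZero N] hY in
/-- The rotation `R(u⁻¹)a = u⁻¹ a u` fixes every `a` commuting with `u`. [cite: Balaban1985Averaging, (56) p.27] -/
theorem conjR_inv_eq_of_commute (u : (Matrix (Fin N) (Fin N) ℂ)ˣ) (a : Matrix (Fin N) (Fin N) ℂ) (h : Commute (u : Matrix (Fin N) (Fin N) ℂ) a) :
    conjR u⁻¹ a = a := by
  rw [conjR_apply, inv_inv, mul_assoc, ← h.eq, ← mul_assoc, Units.inv_mul, one_mul]

/-! ## §2 The plaquette clause -/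

section Plaquette

variable {P : Params} {j : ℕ}

/-- The plaquette variables of the abelian configuration are `gexp` of the lattice curl: `U(∂p) = gexp(curlAt θ p₋ μ ν)`. [cite: Balaban1985Averaging, (9) p.19] -/
theorem plaqHol_gexpAt_curlAt (θ : PBond P j → ℝ) (p : Plaq P j) :
    GaugeField.plaqHol (gexpAt (suGroupModel N) hY θ) p = gexp (suGroupModel N) hY (curlAt θ p.src p.μ p.ν) := by
  rw [plaqHol_gexpAt]; rfl

/-- **★ `dist1 (U(∂p)) ≤ ‖Y‖·|curlAt θ p|`** for the abelian configuration (`dist1 = ‖· − 1‖_op` on `SU(N)`, (24) sharp). [cite: Balaban1985Averaging, (19)+(24) p.21] -/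
theorem dist1_plaqHol_gexpAt_le (θ : PBond P j → ℝ) (p : Plaq P j) :
    dist1 (GaugeField.plaqHol (gexpAt (suGroupModel N) hY θ) p) ≤ ‖Y‖ * |curlAt θ p.src p.μ p.ν| := by
  rw [plaqHol_gexpAt_curlAt hY,
    show dist1 (gexp (suGroupModel N) hY (curlAt θ p.src p.μ p.ν))
      = ‖((gexp (suGroupModel N) hY (curlAt θ p.src p.μ p.ν) : Matrix.specialUnitaryGroup (Fin N) ℂ) : Matrix (Fin N) (Fin N) ℂ) - 1‖ from rfl,
    coe_gexp_su hY, mul_comm]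
  exact norm_exp_smul_sub_one_le hY _

/-- **★★ THE PLAQUETTE CLAUSE FROM THE SUP ROW OF THE CURL**: `|curlAt θ| ≤ δ₁` and `‖Y‖·δ₁ < ε` give `PlaqSmall ε (b ↦ e^{θ(b)Y})`.
[cite: Balaban1985Variational, (2) p.278 (plaquette clause); Balaban1985Averaging, (24) p.21] -/
theorem plaqSmall_gexpAt (θ : PBond P j → ℝ) {δ₁ ε : ℝ} (hθ : ∀ (x : Site P j) (μ ν : Fin P.d), μ ≠ ν → |curlAt θ x μ ν| ≤ δ₁) (hε : ‖Y‖ * δ₁ < ε) :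
    PlaqSmall ε (gexpAt (suGroupModel N) hY θ) := fun p =>
  ((dist1_plaqHol_gexpAt_le hY θ p).trans (mul_le_mul_of_nonneg_left (hθ p.src p.μ p.ν p.hμν.ne) (norm_nonneg _))).trans_lt hε

end Plaquette

/-! ## §3 The divergence clause -/

section Divergence

variable {P : Params} {s : ℕ}

omit [NeZero N] hY in
/-- Transports of an `SU(N)` configuration read in `M_N(ℂ)ˣ` are the included `SU(N)` transports. [cite: Balaban1985Averaging, (9)+(19) pp.19–21] -/
theorem coe_holT_unitsField_toUField (U : GaugeField P s (Matrix.specialUnitaryGroup (Fin N) ℂ)) (x : Site P s) (w : List (Letter P.d)) :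
    ((holT (unitsField (toUField U)) x w : (Matrix (Fin N) (Fin N) ℂ)ˣ) : Matrix (Fin N) (Fin N) ℂ)
      = ((holT U x w : Matrix.specialUnitaryGroup (Fin N) ℂ) : Matrix (Fin N) (Fin N) ℂ) := by
  rw [val_holT_unitsField, holT_toUField]; rfl

/-- A bond variable of the abelian configuration read in `M_N(ℂ)`: `e^{θ(b)Y}`. [cite: Balaban1985Averaging, (19) p.21] -/
theorem coe_unitsField_toUField_gexpAt (θ : PBond P s → ℝ) (b : PBond P s) :
    ((unitsField (toUField (gexpAt (suGroupModel N) hY θ)) b : (Matrix (Fin N) (Fin N) ℂ)ˣ) : Matrix (Fin N) (Fin N) ℂ) = exp (((θ b : ℝ) : ℂ) • Y) := by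
  rw [val_unitsField, ← coe_gexp_su hY (θ b)]; rfl

/-- The plaquette word of the abelian configuration transports to `gexp(curlAt θ y κ μ)` (either orientation). [cite: Balaban1985Averaging, (9) p.19] -/
theorem holT_plaqWord_gexpAt (θ : PBond P s → ℝ) (y : Site P s) (κ μ : Fin P.d) :
    holT (gexpAt (suGroupModel N) hY θ) y (plaqWord κ μ) = gexp (suGroupModel N) hY (curlAt θ y κ μ) := by
  rw [holT_plaqWord]
  simp only [gexpAt, gexp_inv, gexp_add, curlAt]
  congr 1

/-- **THE PLAQUETTE FIELD OF THE ABELIAN CONFIGURATION READ IN `M_N(ℂ)`**: `(∂U)_{κμ}(y) = e^{(curlAt θ y κ μ)·Y}`. [cite: Balaban1985RegularSpaces, (1.2) p.76; Balaban1985Averaging, (9) p.19] -/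
theorem plaqFT_gexpAt (θ : PBond P s → ℝ) (κ μ : Fin P.d) (y : Site P s) :
    plaqFT (unitsField (toUField (gexpAt (suGroupModel N) hY θ))) κ μ y = exp ((((curlAt θ y κ μ : ℝ)) : ℂ) • Y) := by
  unfold plaqFT
  rw [coe_holT_unitsField_toUField, holT_plaqWord_gexpAt hY, coe_gexp_su]

/-- **THE COVARIANT BACKWARD DERIVATIVE OF THE ABELIAN PLAQUETTE FIELD IS THE PLAIN BACKWARD DIFFERENCE**: the rotation `R(U(x, x − e_ν))` fixes `e^{c·Y}` (everything commutes).
[cite: Balaban1985RegularSpaces, (1.1) p.76] -/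
theorem covDerivT_one_gexpAt (θ : PBond P s → ℝ) (ν κ μ : Fin P.d) (x : Site P s) :
    covDerivT 1 (unitsField (toUField (gexpAt (suGroupModel N) hY θ))) ν (plaqFT (unitsField (toUField (gexpAt (suGroupModel N) hY θ))) κ μ) x
      = exp ((((curlAt θ (x.unshift ν) κ μ : ℝ)) : ℂ) • Y) - exp ((((curlAt θ x κ μ : ℝ)) : ℂ) • Y) := by
  unfold covDerivT
  rw [inv_one, one_smul, plaqFT_gexpAt hY, plaqFT_gexpAt hY, conjR_inv_eq_of_commute]
  rw [coe_unitsField_toUField_gexpAt hY]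
  exact commute_exp_smul _ _

/-- **★★ THE DIVERGENCE CLAUSE FROM THE LIPSCHITZ ROW OF THE CURL**: if `|curlAt θ (x + e_λ) κ μ − curlAt θ x κ μ| ≤ δ₂` for all sites and directions then
`‖(D^{1*}_U ∂U)_μ(x)‖ ≤ (d−1)·‖Y‖·δ₂` for the abelian configuration `U = (b ↦ e^{θ(b)Y})`. [cite: Balaban1985RegularSpaces, (1.2) p.76, (1.9) p.77; Balaban1985Averaging, (24) p.21] -/
theorem norm_covDivT_one_gexpAt_le (θ : PBond P s → ℝ) {δ₂ : ℝ}
    (hLip : ∀ (x : Site P s) (lam κ μ : Fin P.d), κ ≠ μ → |curlAt θ (x.shift lam) κ μ - curlAt θ x κ μ| ≤ δ₂) (μ : Fin P.d) (x : Site P s) :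
    ‖covDivT 1 (unitsField (toUField (gexpAt (suGroupModel N) hY θ))) μ x‖ ≤ ((P.d - 1 : ℕ) : ℝ) * (‖Y‖ * δ₂) := by
  have hterm : ∀ ν κ μ' : Fin P.d, κ ≠ μ' →
      ‖covDerivT 1 (unitsField (toUField (gexpAt (suGroupModel N) hY θ))) ν (plaqFT (unitsField (toUField (gexpAt (suGroupModel N) hY θ))) κ μ') x‖ ≤ ‖Y‖ * δ₂ := by
    intro ν κ μ' hne
    rw [covDerivT_one_gexpAt hY]
    have h := hLip (x.unshift ν) ν κ μ' hne
    rw [Site.shift_unshift, abs_sub_comm] at h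
    calc _ ≤ |curlAt θ (x.unshift ν) κ μ' - curlAt θ x κ μ'| * ‖Y‖ := norm_exp_smul_sub_exp_smul_le hY _ _
      _ ≤ δ₂ * ‖Y‖ := mul_le_mul_of_nonneg_right h (norm_nonneg _)
      _ = ‖Y‖ * δ₂ := mul_comm _ _
  unfold covDivT
  calc _ ≤ ‖∑ ν ∈ Finset.Iio μ, covDerivT 1 (unitsField (toUField (gexpAt (suGroupModel N) hY θ))) ν (plaqFT (unitsField (toUField (gexpAt (suGroupModel N) hY θ))) ν μ) x‖
        + ‖∑ ν ∈ Finset.Ioi μ, covDerivT 1 (unitsField (toUField (gexpAt (suGroupModel N) hY θ))) ν (plaqFT (unitsField (toUField (gexpAt (suGroupModel N) hY θ))) μ ν) x‖ :=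
        norm_sub_le _ _
    _ ≤ ∑ ν ∈ Finset.Iio μ, ‖covDerivT 1 (unitsField (toUField (gexpAt (suGroupModel N) hY θ))) ν (plaqFT (unitsField (toUField (gexpAt (suGroupModel N) hY θ))) ν μ) x‖
        + ∑ ν ∈ Finset.Ioi μ, ‖covDerivT 1 (unitsField (toUField (gexpAt (suGroupModel N) hY θ))) ν (plaqFT (unitsField (toUField (gexpAt (suGroupModel N) hY θ))) μ ν) x‖ :=
        add_le_add (norm_sum_le _ _) (norm_sum_le _ _)
    _ ≤ ∑ _ν ∈ Finset.Iio μ, ‖Y‖ * δ₂ + ∑ _ν ∈ Finset.Ioi μ, ‖Y‖ * δ₂ :=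
        add_le_add (sum_le_sum fun ν hν => hterm ν ν μ (ne_of_lt (Finset.mem_Iio.mp hν)))
          (sum_le_sum fun ν hν => hterm ν μ ν (ne_of_lt (Finset.mem_Ioi.mp hν)))
    _ = (((Finset.Iio μ).card : ℝ) + ((Finset.Ioi μ).card : ℝ)) * (‖Y‖ * δ₂) := by
        rw [sum_const, sum_const, nsmul_eq_mul, nsmul_eq_mul]; ring
    _ = ((P.d - 1 : ℕ) : ℝ) * (‖Y‖ * δ₂) := by
        rw [Fin.card_Iio, Fin.card_Ioi, ← Nat.cast_add]
        congr 2
        have := μ.isLt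
        omega

end Divergence

/-! ## §4 The T³ series: `RegPr` of the abelian configuration from the two real rows -/

section T3

variable {Y₂ : Matrix (Fin 2) (Fin 2) ℂ} (hY₂ : Y₂ ∈ (suGroupModel 2).lie)

omit [NeZero N] hY in
/-- **★★★ (R4)-DICT: PRINT'S REGULAR SPACE FOR THE ABELIAN CONFIGURATION FROM THE SUP AND THE LIPSCHITZ ROW OF THE LATTICE CURL** — for the T³ series `F`, run `K`,
comparison height `n`: if the real one-form `θ` on the finest bonds has `|curlAt θ| ≤ δ₁` and `|curlAt θ (x + e_λ) − curlAt θ x| ≤ δ₂`, and the two windows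
`‖Y‖·δ₁ < ε₀L^{−2(K−n)}` (= `regThreshold`), `(d−1)·‖Y‖·δ₂ < ε₀L^{−3(K−n)}` hold, then `b ↦ e^{θ(b)·Y}` lies in `𝔘_{K−n}(ε₀)`: `RegPr F n K ε₀ (gexpAt (suGroupModel 2) hY θ)`.
With ✓`exists_smoothExactLift_torus` (`δ₁ = 54^d·ε/(L^k)²`, `δ₂ = 330·54^{d−1}·ε/(L^k)³`, `k = K − n`) both windows are met by an absolute multiple `CS·ε₁` — the radius LETTER of
`hSymCentre`. [cite: Balaban1985Variational, (2)+(6) p.278; Balaban1985RegularSpaces, (1.7)+(1.9) p.77] -/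
theorem regPr_gexpAt_of_curl_rows (F : T3Family) (n K : ℕ) (ε₀ : ℝ) (θ : PBond (F.P K) 0 → ℝ) {δ₁ δ₂ : ℝ}
    (h1 : ∀ (x : Site (F.P K) 0) (μ ν : Fin (F.P K).d), μ ≠ ν → |curlAt θ x μ ν| ≤ δ₁)
    (h2 : ∀ (x : Site (F.P K) 0) (lam μ ν : Fin (F.P K).d), μ ≠ ν → |curlAt θ (x.shift lam) μ ν - curlAt θ x μ ν| ≤ δ₂)
    (hw1 : ‖Y₂‖ * δ₁ < regThreshold F n K ε₀)
    (hw2 : (((F.P K).d - 1 : ℕ) : ℝ) * (‖Y₂‖ * δ₂) < ε₀ * ((F.L : ℝ)⁻¹) ^ (3 * (K - n))) :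
    RegPr F n K ε₀ (gexpAt (suGroupModel 2) hY₂ θ) :=
  ⟨plaqSmall_gexpAt hY₂ θ h1 hw1, fun b => (norm_covDivT_one_gexpAt_le hY₂ θ h2 b.dir b.src).trans_lt hw2⟩

end T3


/-! ## §5 The diagonal direction `Y = iσ₃` of `SU(2)` (the letter of the reducible sector) -/

section Sigma3

open Literature.MathematicalPhysics.QuantumFieldTheory.Balaban1983to89.B9AdOrthogonal (σ₃)

omit [NeZero N] hY in
/-- **`iσ₃ ∈ 𝔰𝔲(2)`** — the direction of the maximal torus `{diag(e^{it}, e^{−it})}` (the reducible sector `p(V) = 1` of LOCATE #56 after the diagonalising gauge).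
(`σ₃⋆ = σ₃` is ✓`Prop7NestedMeanParallelLiftDiagGauge.star_sigma3`; re-derived inline to keep this dictionary independent of the lift chain.) [cite: Balaban1985Averaging, (22) p.21] -/
theorem I_smul_sigma3_mem_lie : Complex.I • σ₃ ∈ (suGroupModel 2).lie := by
  have hstar : star σ₃ = σ₃ := by
    rw [Matrix.star_eq_conjTranspose]
    ext i j
    fin_cases i <;> fin_cases j <;> simp [σ₃, Matrix.conjTranspose_apply]
  show Complex.I • σ₃ ∈ Literature.Algebra.Lie.CompactKillingForm.su (Fin 2)
  rw [Literature.Algebra.Lie.CompactKillingForm.mem_su_iff]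
  refine ⟨?_, ?_⟩
  · rw [← Matrix.star_eq_conjTranspose, star_smul, hstar, Complex.star_def, Complex.conj_I, neg_smul]
  · rw [Matrix.trace_smul, show σ₃.trace = 0 by simp [σ₃, Matrix.trace_fin_two], smul_zero]

omit [NeZero N] hY in
/-- `‖iσ₃‖ ≤ 1` (`σ₃` is unitary), so the windows of `regPr_gexpAt_of_curl_rows` at `Y = iσ₃` read `δ₁ < regThreshold`, `(d−1)·δ₂ < ε₀L^{−3(K−n)}`. [cite: Balaban1985Averaging, (19) p.21] -/
theorem norm_I_smul_sigma3_le_one : ‖(Complex.I • σ₃ : Matrix (Fin 2) (Fin 2) ℂ)‖ ≤ 1 := by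
  letI : CStarAlgebra (Matrix (Fin 2) (Fin 2) ℂ) := B10Eq29TubeLine.cstarAlgebraMatrix 2
  have hstar : star σ₃ = σ₃ := by
    rw [Matrix.star_eq_conjTranspose]
    ext i j
    fin_cases i <;> fin_cases j <;> simp [σ₃, Matrix.conjTranspose_apply]
  have hsq : σ₃ * σ₃ = 1 := by
    ext i j
    fin_cases i <;> fin_cases j <;> simp [σ₃, Matrix.mul_apply, Fin.sum_univ_two]
  have hu : σ₃ ∈ unitary (Matrix (Fin 2) (Fin 2) ℂ) := by
    rw [Unitary.mem_iff, hstar, hsq]; exact ⟨rfl, rfl⟩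
  rw [norm_smul, Complex.norm_I, one_mul]
  exact B8Ineq170.cstar_unitary_norm_le_one hu

omit [NeZero N] hY in
/-- **THE BOND VALUES OF THE DIAGONAL CONFIGURATION**: `gexpAt (iσ₃) θ b = e^{θ(b)·iσ₃}` read in `M₂(ℂ)`. [cite: Balaban1985Averaging, (3)+(22) pp.18–21] -/
theorem coe_gexpAt_sigma3 {P : Params} {j : ℕ} (θ : PBond P j → ℝ) (b : PBond P j) :
    ((gexpAt (suGroupModel 2) I_smul_sigma3_mem_lie θ b : Matrix.specialUnitaryGroup (Fin 2) ℂ) : Matrix (Fin 2) (Fin 2) ℂ)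
      = exp (((θ b : ℝ) : ℂ) • (Complex.I • σ₃)) :=
  coe_gexp_su I_smul_sigma3_mem_lie (θ b)

end Sigma3

end Summit.QuantumFields.YangMills.Theorems.Prop7SymCentreAbelianDict

end
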